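import Summits.QuantumFields.YangMills.Theorems.BalabanLadderIRcofSchurFejerCyclicKer
import Mathlib.Analysis.Fourier.FiniteAbelian.PontryaginDuality
import HarnessLib

/-!
# Schur–Fejér splitting — §7 (7a): ABSTRACT AMPLITUDE CHARACTERS

Ideator `ym-ir-idea-22` g4 · crux `IRcof` (stmt-QuantumFields-26930) · row 47 stub S2ᵛ; source `Cruxes/IRcof/Lines/equipartition_seam_SchurFejerCore.lean`
rev 9 (883e0174032ff038) §7 «non-cyclic kernels: abstract amplitude characters, two commuting generators, product windows», extracted VERBATIM by the custody
LEAD ym-ir-line-ab-p1 g7 (LEAD LANE PROTOCOL (b); ideator's LAND-ASK #5 22:26:02Z; critic ym-ir-crit-3 g4 «LAND-ASK #5 WORD = GO», with its EFFICIENCY OPTION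
taken: only the pieces the forthcoming §8 (general finite central kernel) REUSES are landed now — `…SchurFejerAmpChar` (7a) and `…SchurFejerProductWindow`
(7c + the product-window clauses); the bicyclic-specific 7b ∕ 7d ∕ 7e are HELD (staged in the LEAD's folder) until §8 lands or stalls).  This file: `ampChar ρH A` (the normalised character `h ↦ tr(A·ρH h)∕tr A` of a PSD amplitude `A` commuting with `ρH`), its symmetry ∕ class-function ∕ continuity ∕ positive-type properties and ★ `isTwistChar_ampChar`; `pow_eq_pow_of_modEq`.
Same namespace `…EquipartitionSeam.SchurFejer` (no wholesale `open` downstream).  Gate-forced only: one-line docstrings where the lint requires them.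
HONEST: the located lemma S2ᵛ of one registered line, tools for further sub-classes; walls S3 ∕ S5ᵛ untouched; width 0; YM mass gap (Clay) NOT proved;
`IRcof` 0∕1; R4 = `BalabanLadder.UV` only.
-/

set_option autoImplicit false

noncomputable section

open Finset Complex

namespace Summit.QuantumFields.YangMills.Cruxes.IRcof.EquipartitionSeam.SchurFejer

open scoped ComplexOrder Matrix

section Amp

open Literature.MathematicalPhysics.QuantumFieldTheory
open Summit.QuantumFields.YangMills.Theorems.NonSimplyConnectedLatticeGap (latticeRep_map_inv)

variable {H : Type} [Group H] [TopologicalSpace H]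

/-- The normalised AMPLITUDE CHARACTER `u_A(h) = tr(Aᴴ A ρH h) / tr(Aᴴ A)` of a matrix `A` commuting with `ρH(H)`. -/
def ampChar (ρH : LatticeRep H) (A : Matrix (Fin ρH.N) (Fin ρH.N) ℂ) (h : H) : ℂ :=
  (Aᴴ * A * ρH.ρ h).trace / (Aᴴ * A).trace

/-- `amp_conjTranspose_comm` (see the module docstring; verbatim from the Lines core §7). -/
theorem amp_conjTranspose_comm (ρH : LatticeRep H) {A : Matrix (Fin ρH.N) (Fin ρH.N) ℂ}
    (hA : ∀ h, A * ρH.ρ h = ρH.ρ h * A) (h : H) : Aᴴ * ρH.ρ h = ρH.ρ h * Aᴴ := by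
  have e := congrArg Matrix.conjTranspose (hA h⁻¹)
  rw [Matrix.conjTranspose_mul, Matrix.conjTranspose_mul, ← latticeRep_map_inv, inv_inv] at e
  exact e.symm

/-- `ampProj_comm` (see the module docstring; verbatim from the Lines core §7). -/
theorem ampProj_comm (ρH : LatticeRep H) {A : Matrix (Fin ρH.N) (Fin ρH.N) ℂ}
    (hA : ∀ h, A * ρH.ρ h = ρH.ρ h * A) (h : H) : Aᴴ * A * ρH.ρ h = ρH.ρ h * (Aᴴ * A) := by
  rw [Matrix.mul_assoc, hA, ← Matrix.mul_assoc, amp_conjTranspose_comm ρH hA, Matrix.mul_assoc]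

/-- `ampProj_mul_rho` (see the module docstring; verbatim from the Lines core §7). -/
theorem ampProj_mul_rho (ρH : LatticeRep H) {A : Matrix (Fin ρH.N) (Fin ρH.N) ℂ}
    (hA : ∀ h, A * ρH.ρ h = ρH.ρ h * A) {k : H} {θ : ℂ} (hk : ρH.ρ k * A = θ • A) :
    Aᴴ * A * ρH.ρ k = θ • (Aᴴ * A) := by
  rw [Matrix.mul_assoc, hA, hk, Matrix.mul_smul]

/-- `posSemidef_ampProj` (see the module docstring; verbatim from the Lines core §7). -/
theorem posSemidef_ampProj {m : ℕ} (A : Matrix (Fin m) (Fin m) ℂ) : (Aᴴ * A).PosSemidef :=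
  Matrix.posSemidef_conjTranspose_mul_self _

/-- `ampProj_trace_eq_re` (see the module docstring; verbatim from the Lines core §7). -/
theorem ampProj_trace_eq_re {m : ℕ} (A : Matrix (Fin m) (Fin m) ℂ) :
    (Aᴴ * A).trace = (((Aᴴ * A).trace.re : ℝ) : ℂ) ∧ 0 ≤ (Aᴴ * A).trace.re := by
  have h := (posSemidef_ampProj A).trace_nonneg
  rw [Complex.nonneg_iff] at h
  refine ⟨Complex.ext (by simp) (by simp [h.2]), h.1⟩

/-- `star_ampProj_trace` (see the module docstring; verbatim from the Lines core §7). -/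
theorem star_ampProj_trace {m : ℕ} (A : Matrix (Fin m) (Fin m) ℂ) :
    starRingEnd ℂ (Aᴴ * A).trace = (Aᴴ * A).trace := by
  rw [(ampProj_trace_eq_re A).1, Complex.conj_ofReal]

/-- `ampChar_twist` (see the module docstring; verbatim from the Lines core §7). -/
theorem ampChar_twist (ρH : LatticeRep H) {A : Matrix (Fin ρH.N) (Fin ρH.N) ℂ}
    (hA : ∀ h, A * ρH.ρ h = ρH.ρ h * A) {k : H} {θ : ℂ} (hk : ρH.ρ k * A = θ • A) (h : H) :
    ampChar ρH A (k * h) = θ * ampChar ρH A h := by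
  unfold ampChar
  rw [map_mul, ← Matrix.mul_assoc, ampProj_mul_rho ρH hA hk, Matrix.smul_mul, Matrix.trace_smul,
    smul_eq_mul, mul_div_assoc]

/-- `ampChar_one` (see the module docstring; verbatim from the Lines core §7). -/
theorem ampChar_one (ρH : LatticeRep H) {A : Matrix (Fin ρH.N) (Fin ρH.N) ℂ}
    (hP : (Aᴴ * A).trace ≠ 0) : ampChar ρH A 1 = 1 := by
  unfold ampChar
  rw [map_one, Matrix.mul_one]
  exact div_self hP

/-- `ampChar_inv` (see the module docstring; verbatim from the Lines core §7). -/
theorem ampChar_inv (ρH : LatticeRep H) (A : Matrix (Fin ρH.N) (Fin ρH.N) ℂ) (h : H) :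
    ampChar ρH A h⁻¹ = starRingEnd ℂ (ampChar ρH A h) := by
  unfold ampChar
  rw [map_div₀, star_ampProj_trace]
  congr 1
  rw [latticeRep_map_inv, ← Complex.star_def, ← Matrix.trace_conjTranspose, Matrix.conjTranspose_mul,
    Matrix.conjTranspose_mul, Matrix.conjTranspose_conjTranspose, Matrix.trace_mul_comm]

/-- `ampChar_conj` (see the module docstring; verbatim from the Lines core §7). -/
theorem ampChar_conj (ρH : LatticeRep H) {A : Matrix (Fin ρH.N) (Fin ρH.N) ℂ}
    (hA : ∀ h, A * ρH.ρ h = ρH.ρ h * A) (g h : H) :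
    ampChar ρH A (g * h * g⁻¹) = ampChar ρH A h := by
  unfold ampChar
  congr 1
  rw [map_mul, map_mul, ← Matrix.mul_assoc, ← Matrix.mul_assoc, Matrix.trace_mul_comm,
    ← Matrix.mul_assoc, ← Matrix.mul_assoc, ← ampProj_comm ρH hA, Matrix.mul_assoc (Aᴴ * A),
    ← map_mul, inv_mul_cancel, map_one, Matrix.mul_one]

/-- `continuous_ampChar` (see the module docstring; verbatim from the Lines core §7). -/
theorem continuous_ampChar (ρH : LatticeRep H) (A : Matrix (Fin ρH.N) (Fin ρH.N) ℂ) :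
    Continuous (ampChar ρH A) :=
  ((continuous_const.mul ρH.continuous).matrix_trace).div_const _

/-- Gram matrices of `h ↦ tr(Aᴴ A ρH h)` are PSD: `tr(AᴴA ρ(x_a⁻¹ x_b)) = tr((A ρ x_a)ᴴ (A ρ x_b))`. -/
theorem posSemidef_ampTrace_gram (ρH : LatticeRep H) {A : Matrix (Fin ρH.N) (Fin ρH.N) ℂ}
    (hA : ∀ h, A * ρH.ρ h = ρH.ρ h * A) {n : ℕ} (x : Fin n → H) :
    (Matrix.of fun a b : Fin n => (Aᴴ * A * ρH.ρ ((x a)⁻¹ * x b)).trace).PosSemidef := by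
  set B : Matrix (Fin ρH.N × Fin ρH.N) (Fin n) ℂ := Matrix.of fun pq b => (A * ρH.ρ (x b)) pq.1 pq.2
    with hB
  have hentry : ∀ a b : Fin n, (Aᴴ * A * ρH.ρ ((x a)⁻¹ * x b)).trace =
      ((A * ρH.ρ (x a))ᴴ * (A * ρH.ρ (x b))).trace := by
    intro a b
    rw [map_mul, ← Matrix.mul_assoc, ampProj_comm ρH hA, Matrix.conjTranspose_mul, ← latticeRep_map_inv]
    simp only [Matrix.mul_assoc]
  have hT : (Matrix.of fun a b : Fin n => (Aᴴ * A * ρH.ρ ((x a)⁻¹ * x b)).trace) = Bᴴ * B := by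
    ext a b
    rw [Matrix.of_apply, hentry]
    simp only [Matrix.trace, Matrix.diag_apply, Matrix.mul_apply, Matrix.conjTranspose_apply, hB,
      Matrix.of_apply, Fintype.sum_prod_type]
    rw [Finset.sum_comm]
  rw [hT]
  exact Matrix.posSemidef_conjTranspose_mul_self B

/-- `ampChar_gram` (see the module docstring; verbatim from the Lines core §7). -/
theorem ampChar_gram (ρH : LatticeRep H) {A : Matrix (Fin ρH.N) (Fin ρH.N) ℂ}
    (hA : ∀ h, A * ρH.ρ h = ρH.ρ h * A) {n : ℕ} (x : Fin n → H) :
    (Matrix.of fun a b : Fin n => ampChar ρH A ((x a)⁻¹ * x b)).PosSemidef := by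
  obtain ⟨htr, hnn⟩ := ampProj_trace_eq_re A
  set t : ℝ := (Aᴴ * A).trace.re with ht
  have hcoef : (0 : ℂ) ≤ ((t⁻¹ : ℝ) : ℂ) := Complex.zero_le_real.2 (inv_nonneg.2 hnn)
  have heq : (Matrix.of fun a b : Fin n => ampChar ρH A ((x a)⁻¹ * x b)) =
      ((t⁻¹ : ℝ) : ℂ) • Matrix.of fun a b : Fin n => (Aᴴ * A * ρH.ρ ((x a)⁻¹ * x b)).trace := by
    ext a b
    simp only [Matrix.of_apply, Matrix.smul_apply, smul_eq_mul, ampChar]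
    rw [htr, div_eq_inv_mul, ← Complex.ofReal_inv]
  rw [heq]
  exact (posSemidef_ampTrace_gram ρH hA x).smul hcoef

/-- **An amplitude character is a twist character for every eigen-relation `ρH(k) A = θ A` of `A`.** -/
theorem isTwistChar_ampChar (ρH : LatticeRep H) {A : Matrix (Fin ρH.N) (Fin ρH.N) ℂ}
    (hA : ∀ h, A * ρH.ρ h = ρH.ρ h * A) {k : H} {θ : ℂ} (hk : ρH.ρ k * A = θ • A)
    (hP : (Aᴴ * A).trace ≠ 0) : IsTwistChar k θ (ampChar ρH A) :=
  ⟨continuous_ampChar ρH A, ampChar_one ρH hP, ampChar_inv ρH A, ampChar_conj ρH hA,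
    ampChar_twist ρH hA hk, fun _ x => ampChar_gram ρH hA x⟩

/-- A power identity from a congruence: `ω^N = 1`, `M ≡ t (mod N)` ⇒ `ω^M = ω^t`. -/
theorem pow_eq_pow_of_modEq {ω : ℂ} {N : ℕ} (hωN : ω ^ N = 1) {M t : ℕ} (h : M ≡ t [MOD N]) :
    ω ^ M = ω ^ t := by
  rw [← Nat.div_add_mod M N, ← Nat.div_add_mod t N, pow_add, pow_add, pow_mul, pow_mul, hωN, one_pow,
    one_pow, one_mul, one_mul]
  unfold Nat.ModEq at h
  rw [h]

end Amp

end Summit.QuantumFields.YangMills.Cruxes.IRcof.EquipartitionSeam.SchurFejer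

end
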